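import Summits.HodgeConjecture.HodgeConjecture.Theses.CrLinkCycles

/-!
# Route `CrLinkCycles` — assembly item `Assembly` (stmt-HodgeConjecture-3356)

`HodgeModels → LinkProjectionExists → LinkCycleExistence → LinkRigidity → GysinKernelDivisorial →
DivisorIdealLift → HodgeConjecture`, by pure logic: for `X` smooth projective of dimension `n` choose a
closed immersion `ι : X ⟶ ℙ^N_ℂ` (`IsSmoothProjective.isProjectiveOver`), let `L` be the link of the
affine cone over `ι(X)` (defined by the membership condition the cruxes quantify over) and `π : L → X(ℂ)`
the projection supplied by `LinkProjectionExists`; for `1 + p + q = n` and a rational `(1+p,1+p)`-class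
`c`, `LinkCycleExistence` gives a maximally complex carrier `W` of `π^* c`, `LinkRigidity` an algebraic
`z` with `π^*(c - z) = 0`, `GysinKernelDivisorial` a decomposition `c - z = d ∪ b` with `d` a divisor
class — this is `HodgeModDivisorIdeal`, and `DivisorIdealLift` turns it (with `HodgeModels`) into the
Hodge conjecture.  No definition, no named-fact hypothesis, no sorry.
-/

set_option linter.dupNamespace false

namespace Summit.HodgeConjecture.HodgeConjecture.Theorems

open Summit.HodgeConjecture.HodgeConjecture.Theses.CrLinkCycles

/-- **The four link items give `HodgeModDivisorIdeal`** (the route's target X, stmt-HodgeConjecture-3349,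
from `LinkProjectionExists`, `LinkCycleExistence`, `LinkRigidity`, `GysinKernelDivisorial` — pure logic:
choose the projective embedding, the link and its projection, then chain the three cruxes).
[cite: Deligne2000, §1] -/
theorem crLinkCycles_hodgeModDivisorIdeal_of_links (hP : LinkProjectionExists)
    (hE : LinkCycleExistence) (hR : LinkRigidity) (hG : GysinKernelDivisorial) :
    HodgeModDivisorIdeal := by
  intro n X hX p q hpq c hc hh
  obtain ⟨N, ι, hι⟩ := hX.isProjectiveOver
  haveI := hι
  set L : Set (Fin (N + 1) → ℂ) := {v | ∑ i, ‖v i‖ ^ 2 = 1 ∧ ∃ hv : v ≠ 0,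
    Literature.NumberTheory.Transcendental.projPoint N (Projectivization.mk ℂ v hv) ∈
      Set.range (Literature.AlgebraicGeometry.Motives.AlgPoints.map ι)} with hLdef
  have hL : ∀ v : Fin (N + 1) → ℂ, v ∈ L ↔ (∑ i, ‖v i‖ ^ 2 = 1 ∧ ∃ hv : v ≠ 0,
      Literature.NumberTheory.Transcendental.projPoint N (Projectivization.mk ℂ v hv) ∈
        Set.range (Literature.AlgebraicGeometry.Motives.AlgPoints.map ι)) := fun v => Iff.rfl
  obtain ⟨π, hπ⟩ := hP N n X hX ι L hL
  obtain ⟨W, hW, hcW⟩ := hE N n X hX ι L hL π hπ p q hpq c hc hh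
  obtain ⟨z, hz, hπz⟩ := hR N n X hX ι L hL π hπ p q hpq c W hW hcW
  obtain ⟨d, hd, b, hb⟩ := hG N n X hX ι L hL π hπ p (c - z) hπz
  exact ⟨z, hz, d, hd, b, by rw [← hb]; abel⟩

/-- **Item stmt-HodgeConjecture-3356 (`Assembly`, route `CrLinkCycles`)**:
`HodgeModels → LinkProjectionExists → LinkCycleExistence → LinkRigidity → GysinKernelDivisorial →
DivisorIdealLift → HodgeConjecture`.  The type is literally the route decl
`Summit.HodgeConjecture.HodgeConjecture.Theses.CrLinkCycles.Assembly`. [cite: Deligne2000, §1] -/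
theorem crLinkCycles_assembly_proof :
    Summit.HodgeConjecture.HodgeConjecture.Theses.CrLinkCycles.Assembly := by
  unfold Summit.HodgeConjecture.HodgeConjecture.Theses.CrLinkCycles.Assembly
  intro hM hP hE hR hG hD
  exact hD hM (crLinkCycles_hodgeModDivisorIdeal_of_links hP hE hR hG)

end Summit.HodgeConjecture.HodgeConjecture.Theorems
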